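import Literature.MathematicalPhysics.QuantumFieldTheory.O2ChargeOneTermwise
import Literature.MathematicalPhysics.QuantumFieldTheory.O2NeutralSectorsCells
import HarnessLib

/-!
# O(2) `{φ, s, t}` scan: CELL rules for the charged `2 × 2` sectors `2⁺` and `1` (ρ-free term tests)

[cite: ChesterEtAl2020, §3.1 (functional conditions)] [cite: HogervorstRychkov2013, §3 eqs. (3.6), (3.9)]
[cite: KosPolandSimmonsduffin2014, §3.3 eq. (3.16), §4 eqs. (4.2)–(4.3)] [cite: DolanOsborn2004, §3 eq. (3.11)]

WHAT THIS FILE DOES (engines lane SDP-4, O(2) client path; Lean side only).  `O2ChargeTwoEvenTermwise`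
(sector `2⁺`, polarisations `(b, z)`) and `O2ChargeOneTermwise` (sector `1`, polarisations `(x, y)`)
reduce the two charged `2 × 2` sector conditions at ONE regular `(Δ, ℓ)` to the nonnegativity of a
weighted sum of BINARY TERM FORMS `Σ_q (A_q(Δ, ℓ)/λ_ℓ) 𝔗_q` over the descendant pairs `q = (n, j)`
(head `q ∈ S`) plus termwise nonnegativity outside `S` (`pos2p_of_dom_termwise`, `pos1_of_dom_termwise`),
with a right-limit clause at non-regular points.  After the conjugation ALIGNMENT of the off-diagonal
blocks each term form is a CONGRUENCE of a kernel matrix: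
`𝔗²⁺_q(b, z) = (b, ρ₊z) M²⁺_q (b, ρ₊z)ᵀ`, `M²⁺_q = [[P_q, Q♮_q/2], [Q♮_q/2, 𝔇_q]]`, and
`𝔗¹_q(x, y) = (ρₛx, ρₜy) M¹_q (ρₛx, ρₜy)ᵀ`, `M¹_q = [[𝔇ˣ_q, W¹♮_q/2], [W¹♮_q/2, 𝔇ʸ_q]]` (all entries
kernel values at `𝒫_{Δ+n,j}`; the Pochhammer ratios `ρ` sit in the congruence only).
A certificate covers `Δ` by CELLS `[lo, hi]`; this file is the cell version, in the format of the neutral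
`0⁻` rule `O2NeutralSectorsCells.pos0m_on_cell_Ico`:
* §1 the generic BINARY HEAD CELL RULE `binHead_nonneg_on_cell` (reader tables `Ulo_q ≤ u_q(Δ)`,
  `Vlo_q ≤ v_q(Δ)`, `|w_q(Δ)| ≤ Wabs_q` on the cell, the interval recursion bounds
  `A⁻_q ≤ A_q(Δ) ≤ A⁺_q` of `hrCoeff_mem_Icc_interval`, and the three closed-form numbers
  `X_lo = headCellSumI ℓ lo hi S Ulo ≥ 0`, `Y_lo = headCellSumI … Vlo ≥ 0`, `Z_abs = headAbsSumI … Wabs`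
  with `Z_abs² ≤ 4 X_lo Y_lo`) and the generic TERMWISE CELL TEST `binTerm_nonneg_on_cell_of_test`;
* §2 sector `2⁺`: the ρ-FREE termwise cell test `dom2pTermForm_nonneg_on_cell_of_test` (tables for the
  kernel entries `P_q`, `𝔇_q`, `Q♮_q` only: `0 ≤ Plo ≤ P_q(Δ)`, `0 ≤ Dlo ≤ 𝔇_q(Δ)`, `|Q♮_q(Δ)| ≤ Qabs`,
  `Qabs² ≤ 4 Plo Dlo`), the head rule `dom2pHead_nonneg_on_cell` (head entries `P_q`, `ρ₊²𝔇_q`,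
  `ρ₊Q♮_q` — the finitely many head levels carry `ρ₊(Δ)`, enclosed on the cell by the reader with
  `ConformalBootstrap3D.DoPochRatioCells`), and the CELL RULE `pos2p_on_cell_Ico`: head numbers + tail
  termwise on the cell ⇒ `Pos2p` at EVERY `Δ ∈ [lo, hi)` (regular points directly, the others by the
  right-limit clause through regular points of the same cell);
* §3 sector `1` (certificate constant `κ > 0` fixed on the cell): the ρ-FREE termwise cell test
  `dom1TermForm_nonneg_on_cell_of_test` (tables for `𝔇ˣ_q`, `𝔇ʸ_q`, `W¹♮_q`), the head rule
  `dom1Head_nonneg_on_cell` (entries `ρₛ²𝔇ˣ_q`, `ρₜ²𝔇ʸ_q`, `ρₛρₜW¹♮_q`), and `pos1_on_cell_Ico`.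

HONEST SCOPE.  (i) The tables are HYPOTHESES valid on the cell; producing them from endpoint data is
the reader's interval arithmetic — node-value enclosures of the kernel `𝒫_{E,j}` exactly as for the
neutral sectors (`𝔇_q` IS the neutral `2⁻` dominated term `dom2mTerm`), and, for the head only, the
`ρ`-enclosures of `ConformalBootstrap3D.DoPochRatioCells` — and is not re-derived here.  (ii) The tail
hypothesis (every term outside `S` on the descendant range nonnegative on the cell) is an infinite
family; since the per-term tests of §2–§3 involve kernel values only (no Pochhammer ratios), it is of the
same apex type as the neutral tails and is meant to be discharged by finitely many termwise cell tests
plus a uniform large-level rule (a later file); this file does not supply the uniform rule.  (iii) `ℓ = 0`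
cells must avoid `Δ = 1` (`hi ≤ 1 ∨ 1 < lo`), where the mixed-weight coefficients are not defined by the
series used.  (iv) Nothing here decides an instance; no numerics.
honest framing: shared numerical engines serving client cells; rigour lives in the verifiers; every
published number belongs to a client cell's ledger, not to the engines group.

DECLARATIONS.  No new definitions; theorems only (kind `proof`).

Sources.  Chester–Landry–Liu–Poland–Simmons-Duffin–Su–Vichi, JHEP 06 (2020) 142, §3.1
(`ChesterEtAl2020`); Hogervorst–Rychkov, Phys. Rev. D 87 (2013) 106004, §3 eqs. (3.6), (3.9)
(`HogervorstRychkov2013`); Kos–Poland–Simmons-Duffin, JHEP 11 (2014) 109, §3.3 eq. (3.16), §4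
eqs. (4.2)–(4.3) (`KosPolandSimmonsduffin2014`); Dolan–Osborn, Nucl. Phys. B 678 (2004) 491, §3
eq. (3.11) (`DolanOsborn2004`).
-/

namespace Literature.MathematicalPhysics.QuantumFieldTheory.O2ChargedSectorsCells

open Finset Set Matrix Filter Topology
open Literature.MathematicalPhysics.QuantumFieldTheory.O2ThreeScalarCrossing
open Literature.MathematicalPhysics.QuantumFieldTheory.O2ThreeScalarSystem
open Literature.MathematicalPhysics.QuantumFieldTheory.O2OPEScanBridge
open Literature.MathematicalPhysics.QuantumFieldTheory.O2ScanObligations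
open Literature.MathematicalPhysics.QuantumFieldTheory.O2NeutralSectorsTermwise
open Literature.MathematicalPhysics.QuantumFieldTheory.O2ChargedSectorsTermwise
open Literature.MathematicalPhysics.QuantumFieldTheory.O2ChargeTwoEvenTermwise
open Literature.MathematicalPhysics.QuantumFieldTheory.O2ChargeOneTermwise
open Literature.MathematicalPhysics.QuantumFieldTheory.O2NeutralSectorsCells (headCellSumI_le_sum
  abs_sum_le_headAbsSumI)
open ConformalBootstrap3D (IsConformalBlock3D IsRegularPoint3D unitarityBound3D accidentalDegeneracy3D
  zMono legendreLam legendreLam_pos InDescendantRange hrCoeff hrCoeffLo hrCoeffHi hrCoeff_mem_Icc_interval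
  headCellSumI headAbsSumI eventually_isRegularPoint3D_nhdsGT_of_bound_le)

/-! ### §1 The generic binary head cell rule and termwise cell test -/

/-- Split of a weighted sum of binary term forms into its three entry sums. Bookkeeping.
[cite: HogervorstRychkov2013, §3 eq. (3.9)] -/
private theorem sum_binTerm_eq (S : Finset (ℕ × ℕ)) (c u v w : ℕ × ℕ → ℝ) (x y : ℝ) :
    ∑ q ∈ S, c q * (x ^ 2 * u q + y ^ 2 * v q + x * y * w q) =
      x ^ 2 * ∑ q ∈ S, c q * u q + y ^ 2 * ∑ q ∈ S, c q * v q + x * y * ∑ q ∈ S, c q * w q := by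
  simp only [Finset.mul_sum, ← Finset.sum_add_distrib]
  exact Finset.sum_congr rfl fun q _ => by ring

/-- Monotonicity of the binary test: `0 ≤ Ulo ≤ U`, `0 ≤ Vlo ≤ V`, `|W| ≤ Wabs`, `Wabs² ≤ 4 Ulo Vlo` give
`W² ≤ 4 U V`. [cite: ChesterEtAl2020, §3.1 ("`M ⪰ 0`")] -/
private theorem sq_le_four_mul_of_tables {U V W Ulo Vlo Wabs : ℝ} (hU : Ulo ≤ U) (hV : Vlo ≤ V)
    (hW : |W| ≤ Wabs) (hX : 0 ≤ Ulo) (hY : 0 ≤ Vlo) (hdet : Wabs ^ 2 ≤ 4 * Ulo * Vlo) :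
    W ^ 2 ≤ 4 * U * V := by
  have hW2 : W ^ 2 ≤ Wabs ^ 2 := by
    rw [← sq_abs W]
    exact pow_le_pow_left₀ (abs_nonneg W) hW 2
  have hUV : Ulo * Vlo ≤ U * V := mul_le_mul hU hV hY (hX.trans hU)
  nlinarith

/-- **BINARY HEAD CELL RULE** (cell `[lo, hi]` strictly above the unitarity bound).  Reader tables
`Ulo_q ≤ u_q`, `Vlo_q ≤ v_q`, `|w_q| ≤ Wabs_q` (at the `Δ ∈ [lo, hi]` in question) and the numbers
`X_lo = headCellSumI ℓ lo hi S Ulo ≥ 0`, `Y_lo = headCellSumI ℓ lo hi S Vlo ≥ 0`,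
`(headAbsSumI ℓ lo hi S Wabs)² ≤ 4 X_lo Y_lo` give
`Σ_{q ∈ S} (A_q(Δ, ℓ)/λ_ℓ)(x² u_q + y² v_q + x y w_q) ≥ 0` for all `(x, y)`.
[cite: HogervorstRychkov2013, §3 eq. (3.9)] [cite: ChesterEtAl2020, §3.1 ("`M ⪰ 0`")] -/
theorem binHead_nonneg_on_cell {ℓ : ℕ} {lo hi Δ : ℝ} (hlo : unitarityBound3D ℓ < lo) (hΔ : Δ ∈ Icc lo hi)
    (S : Finset (ℕ × ℕ)) (u v w Ulo Vlo Wabs : ℕ × ℕ → ℝ)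
    (hU : ∀ q ∈ S, Ulo q ≤ u q) (hV : ∀ q ∈ S, Vlo q ≤ v q) (hW : ∀ q ∈ S, |w q| ≤ Wabs q)
    (hX : 0 ≤ headCellSumI ℓ lo hi S Ulo) (hY : 0 ≤ headCellSumI ℓ lo hi S Vlo)
    (hdet : headAbsSumI ℓ lo hi S Wabs ^ 2 ≤ 4 * headCellSumI ℓ lo hi S Ulo * headCellSumI ℓ lo hi S Vlo)
    (x y : ℝ) :
    0 ≤ ∑ q ∈ S, hrCoeff Δ ℓ q.1 q.2 / legendreLam ℓ * (x ^ 2 * u q + y ^ 2 * v q + x * y * w q) := by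
  have hlam : 0 < legendreLam ℓ := legendreLam_pos ℓ
  have h11 : headCellSumI ℓ lo hi S Ulo ≤ ∑ q ∈ S, hrCoeff Δ ℓ q.1 q.2 * u q :=
    headCellSumI_le_sum hlo hΔ S Ulo u hU
  have h22 : headCellSumI ℓ lo hi S Vlo ≤ ∑ q ∈ S, hrCoeff Δ ℓ q.1 q.2 * v q :=
    headCellSumI_le_sum hlo hΔ S Vlo v hV
  have h12 : |∑ q ∈ S, hrCoeff Δ ℓ q.1 q.2 * w q| ≤ headAbsSumI ℓ lo hi S Wabs :=
    abs_sum_le_headAbsSumI hlo hΔ S Wabs w hW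
  have hB := sq_le_four_mul_of_tables h11 h22 h12 hX hY hdet
  have hform := binForm_nonneg (hX.trans h11) (hY.trans h22) hB x y
  have heq : ∑ q ∈ S, hrCoeff Δ ℓ q.1 q.2 / legendreLam ℓ * (x ^ 2 * u q + y ^ 2 * v q + x * y * w q) =
      (x ^ 2 * ∑ q ∈ S, hrCoeff Δ ℓ q.1 q.2 * u q + y ^ 2 * ∑ q ∈ S, hrCoeff Δ ℓ q.1 q.2 * v q +
        x * y * ∑ q ∈ S, hrCoeff Δ ℓ q.1 q.2 * w q) / legendreLam ℓ := by
    rw [← sum_binTerm_eq, Finset.sum_div]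
    exact Finset.sum_congr rfl fun q _ => by ring
  rw [heq]
  exact div_nonneg (by linarith) hlam.le

/-- **TERMWISE CELL TEST** for one binary term form: tables `0 ≤ Ulo ≤ u`, `0 ≤ Vlo ≤ v`, `|w| ≤ Wabs` with
`Wabs² ≤ 4 Ulo Vlo` give `x² u + y² v + x y w ≥ 0` for all `(x, y)`.
[cite: ChesterEtAl2020, §3.1 ("`M ⪰ 0`")] -/
theorem binTerm_nonneg_on_cell_of_test {u v w Ulo Vlo Wabs : ℝ} (hU : Ulo ≤ u) (hV : Vlo ≤ v)
    (hW : |w| ≤ Wabs) (hX : 0 ≤ Ulo) (hY : 0 ≤ Vlo) (hdet : Wabs ^ 2 ≤ 4 * Ulo * Vlo) (x y : ℝ) :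
    0 ≤ x ^ 2 * u + y ^ 2 * v + x * y * w := by
  have h := binForm_nonneg (hX.trans hU) (hY.trans hV) (sq_le_four_mul_of_tables hU hV hW hX hY hdet) x y
  linarith

/-- `ℓ = 0` cells avoiding `Δ = 1`: `hi ≤ 1 ∨ 1 < lo` gives `Δ ≠ 1` on `[lo, hi)`. Bookkeeping.
[cite: KosPolandSimmonsduffin2014, §4 eqs. (4.2)–(4.3)] -/
private theorem ne_one_of_mem_Ico {ℓ : ℕ} {lo hi : ℝ} (h1 : ℓ = 0 → hi ≤ 1 ∨ 1 < lo) {Δ : ℝ}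
    (hΔ : Δ ∈ Ico lo hi) : ℓ = 0 → Δ ≠ 1 := fun hℓ => by
  rcases h1 hℓ with h | h
  · exact (lt_of_lt_of_le hΔ.2 h).ne
  · exact (lt_of_lt_of_le h hΔ.1).ne'

/-! ### §2 Sector `2⁺` on a cell -/

/-- **`2⁺` TERMWISE CELL TEST, ρ-FREE** (one term `q = (n, j)`): kernel tables `0 ≤ Plo ≤ P_q(Δ)`,
`0 ≤ Dlo ≤ 𝔇_q(Δ)`, `|Q♮_q(Δ)| ≤ Qabs` on the cell with `Qabs² ≤ 4 Plo Dlo` ⇒ `𝔗²⁺_q(b, z; Δ) ≥ 0` for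
all `(b, z)` and all `Δ ∈ [lo, hi]` — no Pochhammer ratio enters.
[cite: ChesterEtAl2020, §3.1 ("`M ⪰ 0`")] [cite: DolanOsborn2004, §3 eq. (3.11)] -/
theorem dom2pTermForm_nonneg_on_cell_of_test (F : ScanFunctional) (D : Dims) {ℓ n j : ℕ} {lo hi : ℝ}
    {Plo Dlo Qabs : ℝ}
    (hP : ∀ Δ ∈ Icc lo hi, Plo ≤ pForm2p F D (zMono (Δ + (n : ℝ)) j))
    (hD : ∀ Δ ∈ Icc lo hi, Dlo ≤ dom2mTerm F D (Δ + (n : ℝ)) j)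
    (hQ : ∀ Δ ∈ Icc lo hi, |qForm2pA F D (zMono (Δ + (n : ℝ)) j)| ≤ Qabs)
    (hX : 0 ≤ Plo) (hY : 0 ≤ Dlo) (hdet : Qabs ^ 2 ≤ 4 * Plo * Dlo) :
    ∀ Δ ∈ Icc lo hi, ∀ b z : ℝ, 0 ≤ dom2pTermForm F D Δ ℓ n j b z := fun Δ hΔ =>
  dom2pTermForm_nonneg_of_test F D (hX.trans (hP Δ hΔ)) (hY.trans (hD Δ hΔ))
    (sq_le_four_mul_of_tables (hP Δ hΔ) (hD Δ hΔ) (hQ Δ hΔ) hX hY hdet)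

/-- **`2⁺` head on a cell**: tables `Plo_q ≤ P_q(Δ)`, `Vlo_q ≤ ρ₊(Δ)² 𝔇_q(Δ)`, `|ρ₊(Δ) Q♮_q(Δ)| ≤ Wabs_q` for
`Δ ∈ [lo, hi]` and the three numbers ⇒ the `2⁺` head sum is `≥ 0` for all `(b, z)` at every `Δ ∈ [lo, hi]`.
[cite: HogervorstRychkov2013, §3 eq. (3.9)] [cite: DolanOsborn2004, §3 eq. (3.11)] -/
theorem dom2pHead_nonneg_on_cell (F : ScanFunctional) (D : Dims) {ℓ : ℕ} {lo hi : ℝ}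
    (hlo : unitarityBound3D ℓ < lo) (S : Finset (ℕ × ℕ)) (Plo Vlo Wabs : ℕ × ℕ → ℝ)
    (hP : ∀ q ∈ S, ∀ Δ ∈ Icc lo hi, Plo q ≤ pForm2p F D (zMono (Δ + (q.1 : ℝ)) q.2))
    (hV : ∀ q ∈ S, ∀ Δ ∈ Icc lo hi,
      Vlo q ≤ rhoPlus2p D Δ ℓ q.1 q.2 ^ 2 * dom2mTerm F D (Δ + (q.1 : ℝ)) q.2)
    (hW : ∀ q ∈ S, ∀ Δ ∈ Icc lo hi,
      |rhoPlus2p D Δ ℓ q.1 q.2 * qForm2pA F D (zMono (Δ + (q.1 : ℝ)) q.2)| ≤ Wabs q)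
    (hX : 0 ≤ headCellSumI ℓ lo hi S Plo) (hY : 0 ≤ headCellSumI ℓ lo hi S Vlo)
    (hdet : headAbsSumI ℓ lo hi S Wabs ^ 2 ≤ 4 * headCellSumI ℓ lo hi S Plo * headCellSumI ℓ lo hi S Vlo) :
    ∀ Δ ∈ Icc lo hi, ∀ b z : ℝ,
      0 ≤ ∑ q ∈ S, hrCoeff Δ ℓ q.1 q.2 / legendreLam ℓ * dom2pTermForm F D Δ ℓ q.1 q.2 b z := by
  intro Δ hΔ b z
  simp only [dom2pTermForm]
  exact binHead_nonneg_on_cell hlo hΔ S (fun q => pForm2p F D (zMono (Δ + (q.1 : ℝ)) q.2))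
    (fun q => rhoPlus2p D Δ ℓ q.1 q.2 ^ 2 * dom2mTerm F D (Δ + (q.1 : ℝ)) q.2)
    (fun q => rhoPlus2p D Δ ℓ q.1 q.2 * qForm2pA F D (zMono (Δ + (q.1 : ℝ)) q.2)) Plo Vlo Wabs
    (fun q hq => hP q hq Δ hΔ) (fun q hq => hV q hq Δ hΔ) (fun q hq => hW q hq Δ hΔ) hX hY hdet b z

/-- **`2⁺` CELL RULE, half-open cell.**  Cell `[lo, hi]` strictly above the unitarity bound, avoiding
`Δ = 1` when `ℓ = 0`; head tables and numbers as in `dom2pHead_nonneg_on_cell`; every term outside `S` on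
the descendant range nonnegative for all `Δ ∈ [lo, hi]` (e.g. by `dom2pTermForm_nonneg_on_cell_of_test`)
⇒ `Pos2p` at EVERY `Δ ∈ [lo, hi)` (regular points by `pos2p_of_dom_termwise`, the others by the
right-limit clause through regular points of the cell).
[cite: KosPolandSimmonsduffin2014, §3.3 eq. (3.16), §4 eqs. (4.2)–(4.3)]
[cite: ChesterEtAl2020, §3.1 (functional conditions)] -/
theorem pos2p_on_cell_Ico (F : ScanFunctional) (D : Dims) {ℓ : ℕ} {lo hi : ℝ}
    (hlo : unitarityBound3D ℓ < lo) (h1 : ℓ = 0 → hi ≤ 1 ∨ 1 < lo)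
    (S : Finset (ℕ × ℕ)) (Plo Vlo Wabs : ℕ × ℕ → ℝ)
    (hP : ∀ q ∈ S, ∀ Δ ∈ Icc lo hi, Plo q ≤ pForm2p F D (zMono (Δ + (q.1 : ℝ)) q.2))
    (hV : ∀ q ∈ S, ∀ Δ ∈ Icc lo hi,
      Vlo q ≤ rhoPlus2p D Δ ℓ q.1 q.2 ^ 2 * dom2mTerm F D (Δ + (q.1 : ℝ)) q.2)
    (hW : ∀ q ∈ S, ∀ Δ ∈ Icc lo hi,
      |rhoPlus2p D Δ ℓ q.1 q.2 * qForm2pA F D (zMono (Δ + (q.1 : ℝ)) q.2)| ≤ Wabs q)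
    (hX : 0 ≤ headCellSumI ℓ lo hi S Plo) (hY : 0 ≤ headCellSumI ℓ lo hi S Vlo)
    (hdet : headAbsSumI ℓ lo hi S Wabs ^ 2 ≤ 4 * headCellSumI ℓ lo hi S Plo * headCellSumI ℓ lo hi S Vlo)
    (htail : ∀ q : ℕ × ℕ, q ∉ S → InDescendantRange ℓ q.1 q.2 →
      ∀ Δ ∈ Icc lo hi, ∀ b z : ℝ, 0 ≤ dom2pTermForm F D Δ ℓ q.1 q.2 b z) :
    ∀ Δ ∈ Ico lo hi, Pos2p F.toFunctional D Δ ℓ := by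
  intro Δ hΔ
  have hhead := dom2pHead_nonneg_on_cell F D hlo S Plo Vlo Wabs hP hV hW hX hY hdet
  have hI : Δ ∈ Icc lo hi := ⟨hΔ.1, hΔ.2.le⟩
  by_cases hr : IsRegularPoint3D Δ ℓ
  · exact pos2p_of_dom_termwise F D (lt_of_lt_of_le hlo hΔ.1) hr.2 (ne_one_of_mem_Ico h1 hΔ) S
      (hhead Δ hI) (fun q hq hrg => htail q hq hrg Δ hI)
  · have hbd : unitarityBound3D ℓ ≤ Δ := hlo.le.trans hΔ.1
    refine pos2p_of_eventually_right F D hr ?_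
    filter_upwards [eventually_isRegularPoint3D_nhdsGT_of_bound_le hbd, Ioo_mem_nhdsGT hΔ.2]
      with Δ' hΔ'reg hΔ'
    have hI' : Δ' ∈ Icc lo hi := ⟨hΔ.1.trans hΔ'.1.le, hΔ'.2.le⟩
    exact ⟨hΔ'reg, fun G hG b z => sector2pForm_nonneg_of_dom_termwise F D (lt_of_lt_of_le hlo hI'.1)
      hΔ'reg.2 (ne_one_of_mem_Ico h1 ⟨hI'.1, hΔ'.2⟩) S (hhead Δ' hI')
      (fun q hq hrg => htail q hq hrg Δ' hI') hG b z⟩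

/-! ### §3 Sector `1` on a cell -/

/-- **Sector-`1` TERMWISE CELL TEST, ρ-FREE** (one term, certificate constant `κ`): kernel tables
`0 ≤ Xlo ≤ 𝔇ˣ_q(Δ)`, `0 ≤ Ylo ≤ 𝔇ʸ_q(Δ)`, `|W¹♮_q(Δ)| ≤ Wabs` on the cell with `Wabs² ≤ 4 Xlo Ylo` ⇒
`𝔗¹_q(x, y; Δ) ≥ 0` for all `(x, y)` and all `Δ ∈ [lo, hi]` — no Pochhammer ratio enters.
[cite: ChesterEtAl2020, §3.1 ("`M ⪰ 0`")] [cite: DolanOsborn2004, §3 eq. (3.11)] -/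
theorem dom1TermForm_nonneg_on_cell_of_test (F : ScanFunctional) (D : Dims) {κ : ℝ} {ℓ n j : ℕ}
    {lo hi : ℝ} {Xlo Ylo Wabs : ℝ}
    (hU : ∀ Δ ∈ Icc lo hi, Xlo ≤ domX1Term F D κ (Δ + (n : ℝ)) j)
    (hV : ∀ Δ ∈ Icc lo hi, Ylo ≤ domY1Term F D κ (Δ + (n : ℝ)) j)
    (hW : ∀ Δ ∈ Icc lo hi, |w1Form1A F D (zMono (Δ + (n : ℝ)) j)| ≤ Wabs)
    (hX : 0 ≤ Xlo) (hY : 0 ≤ Ylo) (hdet : Wabs ^ 2 ≤ 4 * Xlo * Ylo) :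
    ∀ Δ ∈ Icc lo hi, ∀ x y : ℝ, 0 ≤ dom1TermForm F D κ Δ ℓ n j x y := fun Δ hΔ =>
  dom1TermForm_nonneg_of_test F D (hX.trans (hU Δ hΔ)) (hY.trans (hV Δ hΔ))
    (sq_le_four_mul_of_tables (hU Δ hΔ) (hV Δ hΔ) (hW Δ hΔ) hX hY hdet)

/-- **Sector-`1` head on a cell**: tables `Ulo_q ≤ ρₛ(Δ)² 𝔇ˣ_q(Δ)`, `Vlo_q ≤ ρₜ(Δ)² 𝔇ʸ_q(Δ)`,
`|ρₛ(Δ)ρₜ(Δ) W¹♮_q(Δ)| ≤ Wabs_q` for `Δ ∈ [lo, hi]` and the three numbers ⇒ the sector-`1` head sum is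
`≥ 0` for all `(x, y)` at every `Δ ∈ [lo, hi]`.
[cite: HogervorstRychkov2013, §3 eq. (3.9)] [cite: DolanOsborn2004, §3 eq. (3.11)] -/
theorem dom1Head_nonneg_on_cell (F : ScanFunctional) (D : Dims) (κ : ℝ) {ℓ : ℕ} {lo hi : ℝ}
    (hlo : unitarityBound3D ℓ < lo) (S : Finset (ℕ × ℕ)) (Ulo Vlo Wabs : ℕ × ℕ → ℝ)
    (hU : ∀ q ∈ S, ∀ Δ ∈ Icc lo hi,
      Ulo q ≤ rhoS1 D Δ ℓ q.1 q.2 ^ 2 * domX1Term F D κ (Δ + (q.1 : ℝ)) q.2)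
    (hV : ∀ q ∈ S, ∀ Δ ∈ Icc lo hi,
      Vlo q ≤ rhoT1 D Δ ℓ q.1 q.2 ^ 2 * domY1Term F D κ (Δ + (q.1 : ℝ)) q.2)
    (hW : ∀ q ∈ S, ∀ Δ ∈ Icc lo hi,
      |rhoS1 D Δ ℓ q.1 q.2 * rhoT1 D Δ ℓ q.1 q.2 * w1Form1A F D (zMono (Δ + (q.1 : ℝ)) q.2)| ≤ Wabs q)
    (hX : 0 ≤ headCellSumI ℓ lo hi S Ulo) (hY : 0 ≤ headCellSumI ℓ lo hi S Vlo)
    (hdet : headAbsSumI ℓ lo hi S Wabs ^ 2 ≤ 4 * headCellSumI ℓ lo hi S Ulo * headCellSumI ℓ lo hi S Vlo) :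
    ∀ Δ ∈ Icc lo hi, ∀ x y : ℝ,
      0 ≤ ∑ q ∈ S, hrCoeff Δ ℓ q.1 q.2 / legendreLam ℓ * dom1TermForm F D κ Δ ℓ q.1 q.2 x y := by
  intro Δ hΔ x y
  simp only [dom1TermForm]
  exact binHead_nonneg_on_cell hlo hΔ S
    (fun q => rhoS1 D Δ ℓ q.1 q.2 ^ 2 * domX1Term F D κ (Δ + (q.1 : ℝ)) q.2)
    (fun q => rhoT1 D Δ ℓ q.1 q.2 ^ 2 * domY1Term F D κ (Δ + (q.1 : ℝ)) q.2)
    (fun q => rhoS1 D Δ ℓ q.1 q.2 * rhoT1 D Δ ℓ q.1 q.2 * w1Form1A F D (zMono (Δ + (q.1 : ℝ)) q.2))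
    Ulo Vlo Wabs (fun q hq => hU q hq Δ hΔ) (fun q hq => hV q hq Δ hΔ) (fun q hq => hW q hq Δ hΔ)
    hX hY hdet x y

/-- **Sector-`1` CELL RULE, half-open cell**: a certificate constant `κ > 0`, head tables and numbers as
in `dom1Head_nonneg_on_cell`, every term outside `S` on the descendant range nonnegative for all
`Δ ∈ [lo, hi]` (e.g. by `dom1TermForm_nonneg_on_cell_of_test`), cell strictly above the unitarity bound
and avoiding `Δ = 1` when `ℓ = 0` ⇒ `Pos1` at EVERY `Δ ∈ [lo, hi)`.
[cite: KosPolandSimmonsduffin2014, §3.3 eq. (3.16), §4 eqs. (4.2)–(4.3)]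
[cite: ChesterEtAl2020, §3.1 (functional conditions)] -/
theorem pos1_on_cell_Ico (F : ScanFunctional) (D : Dims) {κ : ℝ} (hκ : 0 < κ) {ℓ : ℕ} {lo hi : ℝ}
    (hlo : unitarityBound3D ℓ < lo) (h1 : ℓ = 0 → hi ≤ 1 ∨ 1 < lo)
    (S : Finset (ℕ × ℕ)) (Ulo Vlo Wabs : ℕ × ℕ → ℝ)
    (hU : ∀ q ∈ S, ∀ Δ ∈ Icc lo hi,
      Ulo q ≤ rhoS1 D Δ ℓ q.1 q.2 ^ 2 * domX1Term F D κ (Δ + (q.1 : ℝ)) q.2)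
    (hV : ∀ q ∈ S, ∀ Δ ∈ Icc lo hi,
      Vlo q ≤ rhoT1 D Δ ℓ q.1 q.2 ^ 2 * domY1Term F D κ (Δ + (q.1 : ℝ)) q.2)
    (hW : ∀ q ∈ S, ∀ Δ ∈ Icc lo hi,
      |rhoS1 D Δ ℓ q.1 q.2 * rhoT1 D Δ ℓ q.1 q.2 * w1Form1A F D (zMono (Δ + (q.1 : ℝ)) q.2)| ≤ Wabs q)
    (hX : 0 ≤ headCellSumI ℓ lo hi S Ulo) (hY : 0 ≤ headCellSumI ℓ lo hi S Vlo)
    (hdet : headAbsSumI ℓ lo hi S Wabs ^ 2 ≤ 4 * headCellSumI ℓ lo hi S Ulo * headCellSumI ℓ lo hi S Vlo)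
    (htail : ∀ q : ℕ × ℕ, q ∉ S → InDescendantRange ℓ q.1 q.2 →
      ∀ Δ ∈ Icc lo hi, ∀ x y : ℝ, 0 ≤ dom1TermForm F D κ Δ ℓ q.1 q.2 x y) :
    ∀ Δ ∈ Ico lo hi, Pos1 F.toFunctional D Δ ℓ := by
  intro Δ hΔ
  have hhead := dom1Head_nonneg_on_cell F D κ hlo S Ulo Vlo Wabs hU hV hW hX hY hdet
  have hI : Δ ∈ Icc lo hi := ⟨hΔ.1, hΔ.2.le⟩
  by_cases hr : IsRegularPoint3D Δ ℓ
  · exact pos1_of_dom_termwise F D hκ (lt_of_lt_of_le hlo hΔ.1) hr.2 (ne_one_of_mem_Ico h1 hΔ) S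
      (hhead Δ hI) (fun q hq hrg => htail q hq hrg Δ hI)
  · have hbd : unitarityBound3D ℓ ≤ Δ := hlo.le.trans hΔ.1
    refine pos1_of_eventually_right F D hr ?_
    filter_upwards [eventually_isRegularPoint3D_nhdsGT_of_bound_le hbd, Ioo_mem_nhdsGT hΔ.2]
      with Δ' hΔ'reg hΔ'
    have hI' : Δ' ∈ Icc lo hi := ⟨hΔ.1.trans hΔ'.1.le, hΔ'.2.le⟩
    exact ⟨hΔ'reg, fun G hG x y => sector1Form_nonneg_of_dom_termwise F D (abs_neg_one_pow_le_one ℓ) hκ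
      (lt_of_lt_of_le hlo hI'.1) hΔ'reg.2 (ne_one_of_mem_Ico h1 ⟨hI'.1, hΔ'.2⟩) S (hhead Δ' hI')
      (fun q hq hrg => htail q hq hrg Δ' hI') hG x y⟩

end Literature.MathematicalPhysics.QuantumFieldTheory.O2ChargedSectorsCells
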